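import Summits.PneNP.PneNP.Theses.ExpanderLinearGenerators
import Literature.Computability.MetaComplexity.CliqueColouringCuttingPlanesLowerBound
import HarnessLib

/-!
# The interpolation rungs under `NoPolyBoundedProofSystem` (stmt-PneNP-0097)

`X = NoPolyBoundedProofSystem` (no Cook–Reckhow proof system for `TAUT` is polynomially bounded,
i.e. `NP ≠ coNP`) asks for superpolynomial proof-size lower bounds in EVERY proof system.  This
file records, in the route's Theorems, the two rungs of that ladder obtained by FEASIBLE MONOTONE
INTERPOLATION (Krajíček 1997; Pudlák 1997; Bonet–Pitassi–Raz 1997), both kernel-checked in the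
tree on ONE explicit polynomial-size family, the clique–colouring CNFs
`Clique_{m,⌊√m⌋} ∧ Colour_{m,⌊√m⌋-1}` (`Literature/…/CliqueColouringFormulas.lean`):

* RESOLUTION: every refutation has at least `2^{m^{1/8} - 1}` lines
  (`Literature.Computability.MetaComplexity.cliqueColour_hard_for_resolution`);
* CUTTING PLANES: every refutation `π` has at least `2^{m^{1/8}} / (8 (cpNorm π + 3)³)` lines,
  exponential for polynomially bounded coefficients (`…cliqueColour_hard_for_cuttingPlanes`).

Both rest on the tree's proved Razborov–Alon–Boppana monotone circuit lower bound
(`cliqueSqrt_monotone_lowerBound`).  They do not bear on `X` logically (a lower bound for one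
system decides nothing about all verifiers) — they are calibration: the systems for which `X`'s
demand is met unconditionally now include `R` and `CP*` by interpolation, next to `R` by Haken's
pigeonhole bound and `AC⁰`-Frege by Ajtai's theorem elsewhere in the tree.
-/

-- `Summit.PneNP.PneNP.…` is the tree's mandated summit/sub-problem namespace (single-conjunct summit).
set_option linter.dupNamespace false

namespace Summit.PneNP.PneNP.Theorems

open Filter Literature.Computability.Complexity Literature.Computability.MetaComplexity
  Literature.Computability.MetaComplexity.CliqueColouring

/-- **The interpolation rungs on one family** (Krajíček 1997; Pudlák 1997; Bonet–Pitassi–Raz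
1997): for all large `m` the clique–colouring CNF `Clique_{m,⌊√m⌋} ∧ Colour_{m,⌊√m⌋-1}` is an
unsatisfiable CNF with at most `5 m³` clauses on which, simultaneously, every RESOLUTION
refutation has at least `2^{m^{1/8} - 1}` lines and every CUTTING PLANES refutation `π` has at
least `2^{m^{1/8}} / (8 (cpNorm π + 3)³)` lines. Support for stmt-PneNP-0097
(`NoPolyBoundedProofSystem`): two proof systems certified not polynomially bounded on an explicit
family by the interpolation method. [cite: Pudlak1997, Thm. 1, Thm. 3] [cite: Krajicek1997, §7]
[cite: BonetPitassiRaz1997, §4] -/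
theorem noPolyBoundedProofSystem_interpolationRungs :
    ∀ᶠ m : ℕ in atTop,
      ¬ (cliqueColourCNF m (Nat.sqrt m) (Nat.sqrt m - 1)).Satisfiable ∧
      (cliqueColourCNF m (Nat.sqrt m) (Nat.sqrt m - 1)).length ≤ 5 * m ^ 3 ∧
      (∀ π : List (ResLine (CliqueColouring.Var m (Nat.sqrt m) (Nat.sqrt m - 1))),
        IsResRefutation (cliqueColourCNF m (Nat.sqrt m) (Nat.sqrt m - 1)) π →
          (2 : ℝ) ^ ((m : ℝ) ^ (1 / 8 : ℝ) - 1) ≤ (π.length : ℝ)) ∧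
      (∀ π : List (CPStep (CliqueColouring.Var m (Nat.sqrt m) (Nat.sqrt m - 1))),
        IsCPRefutation (cliqueColourCNF m (Nat.sqrt m) (Nat.sqrt m - 1)) π →
          (2 : ℝ) ^ ((m : ℝ) ^ (1 / 8 : ℝ)) / (8 * ((cpNorm π : ℝ) + 3) ^ 3) ≤ (π.length : ℝ)) := by
  filter_upwards [cliqueColour_hard_for_resolution, cliqueColour_hard_for_cuttingPlanes] with m hR hC
  exact ⟨hR.1, hR.2.1, hR.2.2, hC.2.2⟩

/-- **Resolution and cutting planes are sound refutation systems failing `X`'s demand only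
quantitatively**: the clique–colouring CNFs they cannot refute efficiently ARE unsatisfiable, so
the lower bounds above are about proof LENGTH, not provability — the shape of statement that
`NoPolyBoundedProofSystem` (stmt-PneNP-0097) makes about every proof system. Recorded as the
pair (soundness of `CP`, unsatisfiability of the family). [cite: CookCoullardTuran1987, §2]
[cite: Krajicek1997, §7] -/
theorem noPolyBoundedProofSystem_interpolationRungs_sound (m k c : ℕ) (hck : c < k)
    (π : List (CPStep (CliqueColouring.Var m k c))) :
    (IsCPRefutation (cliqueColourCNF m k c) π → ¬ (cliqueColourCNF m k c).Satisfiable) ∧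
      ¬ (cliqueColourCNF m k c).Satisfiable :=
  ⟨fun h => not_satisfiable_of_isCPRefutation h, cliqueColourCNF_not_satisfiable hck⟩

end Summit.PneNP.PneNP.Theorems
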